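import Summits.MatrixMultiplication.MatrixMultiplication.Theorems.SoloInformedCwTwoCubeKoszulFourRank

/-!
# Explicit border-rank lower bounds for Kronecker powers of the small Coppersmith–Winograd tensor

Numerical instances of `CubeP4.le_algBorderRank_kroneckerPow_cwTensor_two_p4`
(`3315 · 3^(N-3) ≤ 70 · bR(T_{cw,2}^{⊠N})`, obtained from the kernel-certified rank bound `3315`
for a `p = 4` Koszul flattening of the Kronecker cube):

* `bR(T_{cw,2}^{⊠4}) ≥ 143`  (Conner–Gesmundo–Landsberg–Ventura 2022, Thm. 1.2 (iii): `135`),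
* `bR(T_{cw,2}^{⊠5}) ≥ 427`  (loc. cit.: `405`),
* `bR(T_{cw,2}^{⊠6}) ≥ 1279` (loc. cit.: `1215`),
* `bR(T_{cw,2}^{⊠7}) ≥ 3836` (loc. cit.: `3645`).

Remark (informal, not formalised here). Coppersmith–Winograd's deduction
`ω ≤ log₂((4/27) · R(T_{cw,2}^{⊠N})^(3/N))` (`CoppersmithWinograd1990_rank_form` with `q = 2`)
evaluated at these lower bounds gives `2.830, 2.615, 2.488, 2.405` for `N = 3, 4, 5, 6`; in particular
no rank bound for a Kronecker power `N ≤ 6` of `T_{cw,2}` can improve the current record `ω < 2.3713`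
(`N = 6` would need `R ≤ 1219 < 1279`). The first power not excluded this way is `N = 7`
(`R(T_{cw,2}^{⊠7}) ≤ 3987` would be needed; the bound here is `3836`, the trivial upper bound `16384`).

[cite: ConnerGesmundoLandsbergVentura2022, Thm. 1.2 (iii), Prop. 3.2]
[cite: CoppersmithWinograd1990, §6]
-/

namespace Summit.MatrixMultiplication.MatrixMultiplication.Theorems

open Literature.Computability.AlgebraicComplexity

/-- `bR(T_{cw,2}^{⊠4}) ≥ 143` (CGLV 2022 Thm. 1.2 (iii): `≥ 135`).
[cite: ConnerGesmundoLandsbergVentura2022, Thm. 1.2 (iii)] -/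
theorem le_algBorderRank_kroneckerPow_cwTensor_two_four_p4 :
    143 ≤ algBorderRank (kroneckerPow (cwTensor ℂ 2) 4) := by
  have h := CubeP4.le_algBorderRank_kroneckerPow_cwTensor_two_p4 4 (by norm_num)
  norm_num at h
  omega

/-- `bR(T_{cw,2}^{⊠5}) ≥ 427` (CGLV 2022 Thm. 1.2 (iii): `≥ 405`).
[cite: ConnerGesmundoLandsbergVentura2022, Thm. 1.2 (iii)] -/
theorem le_algBorderRank_kroneckerPow_cwTensor_two_five_p4 :
    427 ≤ algBorderRank (kroneckerPow (cwTensor ℂ 2) 5) := by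
  have h := CubeP4.le_algBorderRank_kroneckerPow_cwTensor_two_p4 5 (by norm_num)
  norm_num at h
  omega

/-- `bR(T_{cw,2}^{⊠6}) ≥ 1279` (CGLV 2022 Thm. 1.2 (iii): `≥ 1215`). With Coppersmith–Winograd's
rank form this closes the last case `N ≤ 6` in which a Kronecker power of `T_{cw,2}` could have
improved `ω` (`N = 6` would need rank `≤ 1219`).
[cite: ConnerGesmundoLandsbergVentura2022, Thm. 1.2 (iii)] -/
theorem le_algBorderRank_kroneckerPow_cwTensor_two_six_p4 :
    1279 ≤ algBorderRank (kroneckerPow (cwTensor ℂ 2) 6) := by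
  have h := CubeP4.le_algBorderRank_kroneckerPow_cwTensor_two_p4 6 (by norm_num)
  norm_num at h
  omega

/-- `bR(T_{cw,2}^{⊠7}) ≥ 3836` (CGLV 2022 Thm. 1.2 (iii): `≥ 3645`).
[cite: ConnerGesmundoLandsbergVentura2022, Thm. 1.2 (iii)] -/
theorem le_algBorderRank_kroneckerPow_cwTensor_two_seven_p4 :
    3836 ≤ algBorderRank (kroneckerPow (cwTensor ℂ 2) 7) := by
  have h := CubeP4.le_algBorderRank_kroneckerPow_cwTensor_two_p4 7 (by norm_num)
  norm_num at h
  omega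

end Summit.MatrixMultiplication.MatrixMultiplication.Theorems
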